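import Literature.Analysis.PDE.FreeFlowSobolev
import Literature.Analysis.FluidPDE.SpaceTimeCalculus
import HarnessLib

/-!
# Sup in time of Sobolev energies from time-integrated energies (topic `Analysis/PDE`)

Analytic layer of the programme to prove short-time existence for quasilinear strictly
parabolic systems on a closed manifold (hypothesis `hQL` of
`Literature.Geometry.Riemannian.ricciFlow_shortTime_existence_of_quasilinear`). The Neumann and
Picard iterations of that programme are controlled in time-INTEGRATED Sobolev energies
`∫₀ᵀ E_k(·)` (of the fields and of their time derivatives); joint smoothness of the limits and
the uniform convergence of all derivatives require SUP-in-time control. This file proves the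
one-dimensional Sobolev embedding in time, lifted to every spatial order:

* `norm_sq_le_of_hasDerivWithinAt` — for `g : ℝ → F` continuously differentiable on `[0, T]`
  (within), `‖g(t)‖² ≤ (2/T) ∫₀ᵀ ‖g‖² + 2T ∫₀ᵀ ‖g'‖²` for every `t ∈ [0, T]`
  (`g(t) = g(s) + ∫ₛᵗ g'`, Cauchy–Schwarz, average over `s`);
* `sobolevEnergy_le_lintegral_add_lintegral_timeDerivWithin` — for a field `f` jointly smooth on
  the closed slab `[0, T] × E` (`IsSmoothSpaceTimeOn (Icc 0 T) f`, `T > 0`), every `k`, and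
  every `t ∈ [0, T]`:
  `E_k(f t) ≤ (2/T) ∫₀ᵀ E_k(f s) ds + 2T ∫₀ᵀ E_k(∂ₜf s) ds` (`∂ₜ = timeDerivWithin (Icc 0 T)`),
  by induction on `k` along the recursion `E_{k+1}(h) = ∫‖h‖² + Σᵢ E_k(∂ᵢh)` and the exchange
  `∂ₜ∂ᵢ = ∂ᵢ∂ₜ` at interior times (`hasDerivAt_fderiv_slice_timeDerivWithin`).

Everything is proved; no named fact and no `sorry` is introduced.

## References

* L. C. Evans, *Partial Differential Equations*, 2nd ed., AMS 2010, §5.9.2, Thm. 2 (the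
  embedding `W^{1,2}(0,T; X) ⊂ C([0,T]; X)` with the max-norm bound). [Evans2010]
-/

noncomputable section

open MeasureTheory Set Function Filter Topology TopologicalSpace Metric
open scoped ContDiff ENNReal

namespace Literature.Analysis.PDE

open Literature.Analysis.FluidPDE

variable {E : Type*} [NormedAddCommGroup E] [InnerProductSpace ℝ E] [FiniteDimensional ℝ E]
  [MeasurableSpace E] [BorelSpace E]
variable {F : Type*} [NormedAddCommGroup F] [InnerProductSpace ℝ F]

/-! ### The one-dimensional embedding -/

omit [InnerProductSpace ℝ F] in
/-- Squares and Cauchy–Schwarz: `(∫₀ᵀ ‖h‖)² ≤ T ∫₀ᵀ ‖h‖²` for `h` continuous on `[0, T]`.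
[folklore] -/
theorem sq_integral_norm_le {h : ℝ → F} {T : ℝ} (hT : 0 ≤ T) (hh : ContinuousOn h (Icc 0 T)) :
    (∫ s in (0 : ℝ)..T, ‖h s‖) ^ 2 ≤ T * ∫ s in (0 : ℝ)..T, ‖h s‖ ^ 2 := by
  have hn : ContinuousOn (fun s ↦ ‖h s‖) (Icc 0 T) := hh.norm
  -- Hölder with exponents `2, 2` for the nonnegative functions `1` and `‖h‖` on `(0, T]`
  rw [intervalIntegral.integral_of_le hT, intervalIntegral.integral_of_le hT]
  set μ : Measure ℝ := volume.restrict (Ioc 0 T) with hμ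
  haveI : IsFiniteMeasure μ := by
    rw [hμ]; exact isFiniteMeasure_restrict.2 measure_Ioc_lt_top.ne
  obtain ⟨C, hC⟩ := (isCompact_Icc (a := (0 : ℝ)) (b := T)).exists_bound_of_continuousOn hn
  have hm : MemLp (fun s ↦ ‖h s‖) (ENNReal.ofReal 2) μ := by
    have htop : MemLp (fun s ↦ ‖h s‖) ⊤ μ := by
      refine memLp_top_of_bound ((hn.mono Ioc_subset_Icc_self).aestronglyMeasurable measurableSet_Ioc) C ?_
      rw [hμ, ae_restrict_iff' measurableSet_Ioc]
      exact ae_of_all _ fun s hs ↦ hC s (Ioc_subset_Icc_self hs)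
    exact htop.mono_exponent le_top
  have h1 : MemLp (fun _ : ℝ ↦ (1 : ℝ)) (ENNReal.ofReal 2) μ := memLp_const 1
  have hH := integral_mul_le_Lp_mul_Lq_of_nonneg Real.HolderConjugate.two_two
    (ae_of_all _ fun _ ↦ zero_le_one) (ae_of_all _ fun s ↦ norm_nonneg (h s)) h1 hm
  have hμT : μ.real univ = T := by
    rw [Measure.real, hμ, Measure.restrict_apply_univ, Real.volume_Ioc,
      ENNReal.toReal_ofReal (by linarith), sub_zero]
  simp only [one_mul, mul_one, one_pow, integral_const, smul_eq_mul, hμT, Real.rpow_two] at hH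
  -- square both sides
  have hA0 : 0 ≤ ∫ s, ‖h s‖ ∂μ := integral_nonneg fun _ ↦ norm_nonneg _
  have hB0 : 0 ≤ ∫ s, ‖h s‖ ^ 2 ∂μ := integral_nonneg fun _ ↦ sq_nonneg _
  calc (∫ s, ‖h s‖ ∂μ) ^ 2 ≤ (T ^ (1 / 2 : ℝ) * (∫ s, ‖h s‖ ^ 2 ∂μ) ^ (1 / 2 : ℝ)) ^ 2 :=
        pow_le_pow_left₀ hA0 hH 2
    _ = T * ∫ s, ‖h s‖ ^ 2 ∂μ := by
        rw [mul_pow, ← Real.sqrt_eq_rpow, ← Real.sqrt_eq_rpow, Real.sq_sqrt hT, Real.sq_sqrt hB0]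

omit [InnerProductSpace ℝ F] in
/-- **The one-dimensional Sobolev embedding in time with the explicit constant**: for `g`
differentiable within `[0, T]` with continuous derivative `g'` there, and `t ∈ [0, T]`,
`‖g(t)‖² ≤ (2/T) ∫₀ᵀ ‖g‖² + 2T ∫₀ᵀ ‖g'‖²`. [cite: Evans2010, §5.9.2, Thm. 2] -/
theorem norm_sq_le_of_hasDerivWithinAt [NormedSpace ℝ F] [CompleteSpace F] {g g' : ℝ → F} {T : ℝ}
    (hT : 0 < T) (hg : ∀ s ∈ Icc 0 T, HasDerivWithinAt g (g' s) (Icc 0 T) s)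
    (hg' : ContinuousOn g' (Icc 0 T)) {t : ℝ} (ht : t ∈ Icc 0 T) :
    ‖g t‖ ^ 2 ≤ 2 / T * (∫ s in (0 : ℝ)..T, ‖g s‖ ^ 2) + 2 * T * ∫ s in (0 : ℝ)..T, ‖g' s‖ ^ 2 := by
  have hgc : ContinuousOn g (Icc 0 T) := fun s hs ↦ (hg s hs).continuousWithinAt
  -- the fundamental theorem of calculus between two points of `[0, T]`
  have hftc : ∀ a b, a ∈ Icc 0 T → b ∈ Icc 0 T → a ≤ b → g b - g a = ∫ s in a..b, g' s := by
    intro a b ha hb hab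
    have hsub : Icc a b ⊆ Icc 0 T := Icc_subset_Icc ha.1 hb.2
    refine (intervalIntegral.integral_eq_sub_of_hasDeriv_right_of_le hab (hgc.mono hsub)
      (fun s hs ↦ ?_) ((hg'.mono hsub).intervalIntegrable_of_Icc hab)).symm
    have hs' : s ∈ Ioo 0 T := ⟨ha.1.trans_lt hs.1, hs.2.trans_le hb.2⟩
    exact ((hg s (Ioo_subset_Icc_self hs')).hasDerivAt (Icc_mem_nhds hs'.1 hs'.2)).hasDerivWithinAt
  -- `‖g t - g s‖ ≤ ∫₀ᵀ ‖g'‖` for all `s ∈ [0, T]`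
  set D := ∫ s in (0 : ℝ)..T, ‖g' s‖ with hD
  have hD0 : 0 ≤ D := intervalIntegral.integral_nonneg hT.le fun s _ ↦ norm_nonneg _
  have hnorm_int : ∀ a b, a ∈ Icc 0 T → b ∈ Icc 0 T → a ≤ b → ‖∫ s in a..b, g' s‖ ≤ D := by
    intro a b ha hb hab
    calc ‖∫ s in a..b, g' s‖ ≤ ∫ s in a..b, ‖g' s‖ :=
          intervalIntegral.norm_integral_le_integral_norm hab
      _ ≤ D := by
          rw [hD]
          exact intervalIntegral.integral_mono_interval ha.1 hab hb.2
            (Filter.Eventually.of_forall fun _ ↦ norm_nonneg _)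
            (hg'.norm.intervalIntegrable_of_Icc hT.le)
  have hdiff : ∀ s ∈ Icc 0 T, ‖g t‖ ≤ ‖g s‖ + D := by
    intro s hs
    rcases le_total s t with hst | hts
    · have h := hftc s t hs ht hst
      calc ‖g t‖ = ‖g s + (g t - g s)‖ := by rw [add_sub_cancel]
        _ ≤ ‖g s‖ + ‖g t - g s‖ := norm_add_le _ _
        _ ≤ ‖g s‖ + D := by rw [h]; exact add_le_add le_rfl (hnorm_int s t hs ht hst)
    · have h := hftc t s ht hs hts
      calc ‖g t‖ = ‖g s - (g s - g t)‖ := by rw [sub_sub_cancel]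
        _ ≤ ‖g s‖ + ‖g s - g t‖ := norm_sub_le _ _
        _ ≤ ‖g s‖ + D := by rw [h]; exact add_le_add le_rfl (hnorm_int t s ht hs hts)
  -- square: `‖g t‖² ≤ 2‖g s‖² + 2D²`, `D² ≤ T ∫ ‖g'‖²`
  have hDsq : D ^ 2 ≤ T * ∫ s in (0 : ℝ)..T, ‖g' s‖ ^ 2 := sq_integral_norm_le hT.le hg'
  have hpt : ∀ s ∈ Icc 0 T, ‖g t‖ ^ 2 ≤ 2 * ‖g s‖ ^ 2 + 2 * (T * ∫ s in (0 : ℝ)..T, ‖g' s‖ ^ 2) := by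
    intro s hs
    have h := hdiff s hs
    have h0 : 0 ≤ ‖g s‖ + D := by positivity
    calc ‖g t‖ ^ 2 ≤ (‖g s‖ + D) ^ 2 := pow_le_pow_left₀ (norm_nonneg _) h 2
      _ ≤ 2 * ‖g s‖ ^ 2 + 2 * D ^ 2 := by nlinarith [sq_nonneg (‖g s‖ - D)]
      _ ≤ 2 * ‖g s‖ ^ 2 + 2 * (T * ∫ s in (0 : ℝ)..T, ‖g' s‖ ^ 2) := by linarith
  -- integrate in `s` over `[0, T]`
  have hi1 : IntervalIntegrable (fun s ↦ 2 * ‖g s‖ ^ 2) volume 0 T :=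
    ((hgc.norm.pow 2).intervalIntegrable_of_Icc hT.le).const_mul 2
  have hI := intervalIntegral.integral_mono_on hT.le intervalIntegrable_const
    (hi1.add intervalIntegrable_const) hpt
  rw [intervalIntegral.integral_const, smul_eq_mul, sub_zero,
    intervalIntegral.integral_add hi1 intervalIntegrable_const,
    intervalIntegral.integral_const_mul, intervalIntegral.integral_const, smul_eq_mul, sub_zero] at hI
  -- `T ‖g t‖² ≤ 2 ∫‖g‖² + T (2T ∫‖g'‖²)`; divide by `T`
  have h2 : ‖g t‖ ^ 2 = T⁻¹ * (T * ‖g t‖ ^ 2) := by field_simp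
  rw [h2]
  calc T⁻¹ * (T * ‖g t‖ ^ 2)
      ≤ T⁻¹ * ((2 * ∫ s in (0 : ℝ)..T, ‖g s‖ ^ 2) + T * (2 * (T * ∫ s in (0 : ℝ)..T, ‖g' s‖ ^ 2))) :=
        mul_le_mul_of_nonneg_left hI (inv_pos.2 hT).le
    _ = 2 / T * (∫ s in (0 : ℝ)..T, ‖g s‖ ^ 2) + 2 * T * ∫ s in (0 : ℝ)..T, ‖g' s‖ ^ 2 := by
        field_simp

/-! ### Slab fields: measurability and splitting of time integrals of energies -/

variable {T : ℝ}

/-- The time integral of the energies splits along the recursion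
`E_{k+1}(h) = ∫‖h‖² + Σₗ E_k(∂ₗh)` (field jointly smooth on an open time set). [folklore] -/
theorem lintegral_sobolevEnergy_succ_slice_of_isOpen {S : Set ℝ} (hS : IsOpen S) {Θ : ℝ → E → F}
    (hΘ : IsSmoothSpaceTimeOn S Θ) (k : ℕ) :
    ∫⁻ s in S, sobolevEnergy (k + 1) (Θ s) = (∫⁻ s in S, ∫⁻ x, ‖Θ s x‖ₑ ^ 2) +
      ∑ l, ∫⁻ s in S, sobolevEnergy k (fun y ↦ fderiv ℝ (Θ s) y (stdOrthonormalBasis ℝ E l)) := by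
  have hA : AEMeasurable (fun s ↦ ∫⁻ x, ‖Θ s x‖ₑ ^ 2) (volume.restrict S) := by
    simpa using aemeasurable_sobolevEnergy_slice hS 0 hΘ
  simp only [sobolevEnergy_succ]
  rw [lintegral_add_left' hA, lintegral_finsetSum']
  exact fun l _ ↦ aemeasurable_sobolevEnergy_slice hS k (hΘ.isSmoothSpaceTimeOn_fderiv_apply hS _)

omit [FiniteDimensional ℝ E] [MeasurableSpace E] [BorelSpace E] in
/-- The spatial derivatives of a field jointly smooth on `[0, T]` are jointly smooth on `[0, T]`
(`T > 0`). [folklore] -/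
theorem isSmoothSpaceTimeOn_fderiv_apply_Icc (hT : 0 < T) {f : ℝ → E → F}
    (hf : IsSmoothSpaceTimeOn (Icc 0 T) f) (v : E) : IsSmoothSpaceTimeOn (Icc 0 T) fun t x ↦ fderiv ℝ (f t) x v :=
  (hf.fderiv_slice (uniqueDiffOn_Icc hT)).clm_apply (isSmoothSpaceTimeOn_const_time contDiff_const _)

omit [FiniteDimensional ℝ E] [MeasurableSpace E] [BorelSpace E] in
/-- At interior times the time derivative (within `[0, T]`) of a spatial derivative is the
spatial derivative of the time derivative: for `s ∈ (0, T)`,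
`∂ₜ(∂ᵥf)(s) = ∂ᵥ(∂ₜf)(s)` as slice functions. [folklore] -/
theorem timeDerivWithin_fderiv_apply_eq {f : ℝ → E → F} (hf : IsSmoothSpaceTimeOn (Icc 0 T) f) (v : E)
    {s : ℝ} (hs : s ∈ Ioo 0 T) :
    timeDerivWithin (Icc 0 T) (fun t x ↦ fderiv ℝ (f t) x v) s =
      fun x ↦ fderiv ℝ (timeDerivWithin (Icc 0 T) f s) x v := by
  rw [timeDerivWithin_eq_deriv_of_isOpen_subset isOpen_Ioo Ioo_subset_Icc_self hs]
  funext x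
  have h := hf.hasDerivAt_fderiv_slice_timeDerivWithin isOpen_Ioo Ioo_subset_Icc_self hs x
  have h2 : HasDerivAt (fun t ↦ fderiv ℝ (f t) x v) (fderiv ℝ (timeDerivWithin (Icc 0 T) f s) x v) s := by
    have := h.clm_apply (hasDerivAt_const s v)
    simpa using this
  exact h2.deriv

/-! ### The embedding at every spatial order -/

omit [InnerProductSpace ℝ F] in
/-- Conversion of the real interval integral of a continuous square norm to `lintegral` form.
[folklore] -/
theorem ofReal_intervalIntegral_norm_sq {φ : ℝ → F} (hT : 0 < T) (hφ : ContinuousOn φ (Icc 0 T)) :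
    ENNReal.ofReal (∫ s in (0 : ℝ)..T, ‖φ s‖ ^ 2) = ∫⁻ s in Ioo 0 T, ‖φ s‖ₑ ^ 2 := by
  have hi : IntegrableOn (fun s ↦ ‖φ s‖ ^ 2) (Ioc 0 T) volume :=
    ((hφ.norm.pow 2).integrableOn_Icc).mono_set Ioc_subset_Icc_self
  rw [intervalIntegral.integral_of_le hT.le, ofReal_integral_eq_lintegral_ofReal hi
    (ae_of_all _ fun _ ↦ sq_nonneg _), Measure.restrict_congr_set Ioo_ae_eq_Ioc.symm]
  refine lintegral_congr fun s ↦ ?_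
  rw [← ofReal_norm, ENNReal.ofReal_pow (norm_nonneg _)]

omit [FiniteDimensional ℝ E] [MeasurableSpace E] [BorelSpace E] in
/-- Order `0`, pointwise in `x`, `lintegral` form. [cite: Evans2010, §5.9.2, Thm. 2] -/
theorem enorm_sq_le_lintegral_add_lintegral_timeDerivWithin [CompleteSpace F] (hT : 0 < T)
    {f : ℝ → E → F} (hf : IsSmoothSpaceTimeOn (Icc 0 T) f) {t : ℝ} (ht : t ∈ Icc 0 T) (x : E) :
    ‖f t x‖ₑ ^ 2 ≤ ENNReal.ofReal (2 / T) * (∫⁻ s in Ioo 0 T, ‖f s x‖ₑ ^ 2) +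
      ENNReal.ofReal (2 * T) * ∫⁻ s in Ioo 0 T, ‖timeDerivWithin (Icc 0 T) f s x‖ₑ ^ 2 := by
  have hU := uniqueDiffOn_Icc hT
  have hg : ∀ s ∈ Icc 0 T, HasDerivWithinAt (fun τ ↦ f τ x) (timeDerivWithin (Icc 0 T) f s x) (Icc 0 T) s :=
    fun s hs ↦ hf.hasDerivWithinAt_timeDerivWithin hU hs x
  have hg' : ContinuousOn (fun s ↦ timeDerivWithin (Icc 0 T) f s x) (Icc 0 T) :=
    (hf.continuousOn_timeDerivWithin hU).comp (continuous_id.prodMk continuous_const).continuousOn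
      fun s hs ↦ mk_mem_prod hs (mem_univ _)
  have hgc : ContinuousOn (fun s ↦ f s x) (Icc 0 T) := fun s hs ↦ (hg s hs).continuousWithinAt
  have h := norm_sq_le_of_hasDerivWithinAt hT hg hg' ht
  rw [← ofReal_intervalIntegral_norm_sq hT hgc, ← ofReal_intervalIntegral_norm_sq hT hg',
    ← ofReal_norm, ← ENNReal.ofReal_pow (norm_nonneg _),
    ← ENNReal.ofReal_mul (by positivity), ← ENNReal.ofReal_mul (by positivity),
    ← ENNReal.ofReal_add ?_ ?_]
  · exact ENNReal.ofReal_le_ofReal h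
  · exact mul_nonneg (by positivity) (intervalIntegral.integral_nonneg hT.le fun _ _ ↦ sq_nonneg _)
  · exact mul_nonneg (by positivity) (intervalIntegral.integral_nonneg hT.le fun _ _ ↦ sq_nonneg _)

/-- Joint measurability of the integrand `(x, s) ↦ ‖f s x‖ₑ²` on `E × (0, T)`. [folklore] -/
theorem aemeasurable_enorm_sq_slab {f : ℝ → E → F} (hf : IsSmoothSpaceTimeOn (Icc 0 T) f) :
    AEMeasurable (fun q : E × ℝ ↦ ‖f q.2 q.1‖ₑ ^ 2)
      ((volume : Measure E).prod (volume.restrict (Ioo 0 T))) := by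
  have hc : ContinuousOn (fun q : E × ℝ ↦ ‖f q.2 q.1‖ₑ ^ 2) (univ ×ˢ Ioo 0 T) := by
    have h1 : ContinuousOn (fun q : E × ℝ ↦ f q.2 q.1) (univ ×ˢ Ioo 0 T) :=
      (hf.mono Ioo_subset_Icc_self).continuousOn.comp (continuous_snd.prodMk continuous_fst).continuousOn
        fun q hq ↦ mk_mem_prod (mem_prod.1 hq).2 (mem_univ _)
    exact (ENNReal.continuous_pow 2).comp_continuousOn (continuous_enorm.comp_continuousOn h1)
  have h := hc.aemeasurable (μ := (volume : Measure E).prod (volume : Measure ℝ))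
    (MeasurableSet.univ.prod measurableSet_Ioo)
  rwa [← Measure.prod_restrict, Measure.restrict_univ] at h

/-- Order `0`, integrated in `x`. [cite: Evans2010, §5.9.2, Thm. 2] -/
theorem lintegral_enorm_sq_le_lintegral_add_lintegral_timeDerivWithin [CompleteSpace F] (hT : 0 < T)
    {f : ℝ → E → F} (hf : IsSmoothSpaceTimeOn (Icc 0 T) f) {t : ℝ} (ht : t ∈ Icc 0 T) :
    (∫⁻ x, ‖f t x‖ₑ ^ 2) ≤
      ENNReal.ofReal (2 / T) * (∫⁻ s in Ioo 0 T, ∫⁻ x, ‖f s x‖ₑ ^ 2) +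
        ENNReal.ofReal (2 * T) * ∫⁻ s in Ioo 0 T, ∫⁻ x, ‖timeDerivWithin (Icc 0 T) f s x‖ₑ ^ 2 := by
  have hU := uniqueDiffOn_Icc hT
  have hft := hf.timeDerivWithin hU
  have hm1 := (aemeasurable_enorm_sq_slab hf).lintegral_prod_right'
  have hm2 := (aemeasurable_enorm_sq_slab hft).lintegral_prod_right'
  calc ∫⁻ x, ‖f t x‖ₑ ^ 2
      ≤ ∫⁻ x, (ENNReal.ofReal (2 / T) * (∫⁻ s in Ioo 0 T, ‖f s x‖ₑ ^ 2) +
          ENNReal.ofReal (2 * T) * ∫⁻ s in Ioo 0 T, ‖timeDerivWithin (Icc 0 T) f s x‖ₑ ^ 2) :=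
        lintegral_mono fun x ↦ enorm_sq_le_lintegral_add_lintegral_timeDerivWithin hT hf ht x
    _ = ENNReal.ofReal (2 / T) * (∫⁻ x, ∫⁻ s in Ioo 0 T, ‖f s x‖ₑ ^ 2) +
          ENNReal.ofReal (2 * T) * ∫⁻ x, ∫⁻ s in Ioo 0 T, ‖timeDerivWithin (Icc 0 T) f s x‖ₑ ^ 2 := by
        rw [lintegral_add_left' (hm1.const_mul _), lintegral_const_mul'' _ hm1,
          lintegral_const_mul'' _ hm2]
    _ = ENNReal.ofReal (2 / T) * (∫⁻ s in Ioo 0 T, ∫⁻ x, ‖f s x‖ₑ ^ 2) +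
          ENNReal.ofReal (2 * T) * ∫⁻ s in Ioo 0 T, ∫⁻ x, ‖timeDerivWithin (Icc 0 T) f s x‖ₑ ^ 2 := by
        rw [lintegral_lintegral_swap (f := fun x s ↦ ‖f s x‖ₑ ^ 2) (aemeasurable_enorm_sq_slab hf),
          lintegral_lintegral_swap (f := fun x s ↦ ‖timeDerivWithin (Icc 0 T) f s x‖ₑ ^ 2)
            (aemeasurable_enorm_sq_slab hft)]

/-- **Sup in time of the Sobolev energies from time-integrated energies, every order**: for a
field `f` jointly smooth on `[0, T] × E` (`T > 0`), every `k`, and every `t ∈ [0, T]`,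
`E_k(f t) ≤ (2/T) ∫₀ᵀ E_k(f s) ds + 2T ∫₀ᵀ E_k(∂ₜf s) ds` with `∂ₜ = timeDerivWithin (Icc 0 T)`.
[cite: Evans2010, §5.9.2, Thm. 2] -/
theorem sobolevEnergy_le_lintegral_add_lintegral_timeDerivWithin [CompleteSpace F] (hT : 0 < T)
    (k : ℕ) {f : ℝ → E → F} (hf : IsSmoothSpaceTimeOn (Icc 0 T) f) {t : ℝ} (ht : t ∈ Icc 0 T) :
    sobolevEnergy k (f t) ≤
      ENNReal.ofReal (2 / T) * (∫⁻ s in Ioo 0 T, sobolevEnergy k (f s)) +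
        ENNReal.ofReal (2 * T) * ∫⁻ s in Ioo 0 T, sobolevEnergy k (timeDerivWithin (Icc 0 T) f s) := by
  induction k generalizing f t with
  | zero =>
    simp only [sobolevEnergy_zero_left]
    exact lintegral_enorm_sq_le_lintegral_add_lintegral_timeDerivWithin hT hf ht
  | succ k ih =>
    have hU := uniqueDiffOn_Icc hT
    have hft := hf.timeDerivWithin hU
    have hfi : ∀ i, IsSmoothSpaceTimeOn (Icc 0 T) (fun s x ↦ fderiv ℝ (f s) x (stdOrthonormalBasis ℝ E i)) :=
      fun i ↦ isSmoothSpaceTimeOn_fderiv_apply_Icc hT hf _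
    rw [sobolevEnergy_succ,
      lintegral_sobolevEnergy_succ_slice_of_isOpen isOpen_Ioo (hf.mono Ioo_subset_Icc_self),
      lintegral_sobolevEnergy_succ_slice_of_isOpen isOpen_Ioo (hft.mono Ioo_subset_Icc_self),
      mul_add, mul_add, Finset.mul_sum, Finset.mul_sum]
    -- exchange `∂ₜ∂ᵢ = ∂ᵢ∂ₜ` inside the time integrals over `(0, T)`
    have hswap : ∀ i, ∫⁻ s in Ioo 0 T, sobolevEnergy k
        (timeDerivWithin (Icc 0 T) (fun s x ↦ fderiv ℝ (f s) x (stdOrthonormalBasis ℝ E i)) s) =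
        ∫⁻ s in Ioo 0 T, sobolevEnergy k
          (fun x ↦ fderiv ℝ (timeDerivWithin (Icc 0 T) f s) x (stdOrthonormalBasis ℝ E i)) := by
      intro i
      refine setLIntegral_congr_fun measurableSet_Ioo fun s hs ↦ ?_
      rw [timeDerivWithin_fderiv_apply_eq hf _ hs]
    have hterms : ∀ i, sobolevEnergy k (fun x ↦ fderiv ℝ (f t) x (stdOrthonormalBasis ℝ E i)) ≤
        ENNReal.ofReal (2 / T) * (∫⁻ s in Ioo 0 T, sobolevEnergy k
            (fun x ↦ fderiv ℝ (f s) x (stdOrthonormalBasis ℝ E i))) +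
          ENNReal.ofReal (2 * T) * ∫⁻ s in Ioo 0 T, sobolevEnergy k
            (fun x ↦ fderiv ℝ (timeDerivWithin (Icc 0 T) f s) x (stdOrthonormalBasis ℝ E i)) := by
      intro i
      have h := ih (hfi i) ht
      rw [hswap i] at h
      exact h
    calc (∫⁻ x, ‖f t x‖ₑ ^ 2) + ∑ i, sobolevEnergy k (fun x ↦ fderiv ℝ (f t) x (stdOrthonormalBasis ℝ E i))
        ≤ (ENNReal.ofReal (2 / T) * (∫⁻ s in Ioo 0 T, ∫⁻ x, ‖f s x‖ₑ ^ 2) +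
            ENNReal.ofReal (2 * T) * ∫⁻ s in Ioo 0 T, ∫⁻ x, ‖timeDerivWithin (Icc 0 T) f s x‖ₑ ^ 2) +
          ∑ i, (ENNReal.ofReal (2 / T) * (∫⁻ s in Ioo 0 T, sobolevEnergy k
              (fun x ↦ fderiv ℝ (f s) x (stdOrthonormalBasis ℝ E i))) +
            ENNReal.ofReal (2 * T) * ∫⁻ s in Ioo 0 T, sobolevEnergy k
              (fun x ↦ fderiv ℝ (timeDerivWithin (Icc 0 T) f s) x (stdOrthonormalBasis ℝ E i))) :=
          add_le_add (lintegral_enorm_sq_le_lintegral_add_lintegral_timeDerivWithin hT hf ht)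
            (Finset.sum_le_sum fun i _ ↦ hterms i)
      _ = _ := by
          rw [Finset.sum_add_distrib]
          ring

end Literature.Analysis.PDE

end
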